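import Summits.CriticalPhenomena.SAWScalingLimit.Theorems.BoundaryClosureR.Negative.RootPin
import Literature.Probability.RandomPlanarGeometry.HexSAWLemma2

/-!
# Negative knowledge on crux `BoundaryClosureR` (stmt-CriticalPhenomena-14004), cycle 2, part 1/2:
a root INSIDE the gate ball — the arc bound

Support for `Negative/FlatGateBudget.lean` (`not_flatGateBudget`: the typed positive-mass input
`FlatGateBudget` of the gate line — cards runge-gated-green-pairing / sector-bootstrap,
`Cruxes/BoundaryClosureR/Ideator1Sketch.lean` — is false as typed, because nothing keeps the root `pt 0`
out of the gate ball `ball (pt 1) ρ`).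

Contents: the vertical root edge `hang k` hanging below the up-face of cell `k` of row `0`
(midpoint `k + 1/2`, a boundary mid-edge of the cycle-1 half-disc family `Lam δ false` for
`k = kOf δ = ⌊1/(5δ)⌋₊`); the chart `chartK k = hvIso ∘ shift(-k, 0)` taking it to DCS's entrance
`{wOut, hvOrigin}`; the weight-preserving injective coding of the walks `hang k → bEdge` by α-arcs of
the coordinate strip with final dart `dartK k` (distinct for distinct `k`), whence
`sum_norm_obs_le_stripA`: walks rooted at DIFFERENT cells, in different domains all sitting in one
strip `S_{T,L}`, have total `σ = 0` mass at `bEdge` at most `A_{T,L}(x_c) ≤ 1/cos(3π/8)` (DCS Lemma 2).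
Everything proved. [folklore]
-/

noncomputable section

open Set Filter Topology Complex Finset
open Literature.Probability.RandomPlanarGeometry
open Literature.Probability.LatticeModels Literature.Probability.RandomPlanarGeometry.SAW
open Literature.Probability.RandomPlanarGeometry.SAW.HV

namespace Summit.CriticalPhenomena.SAWScalingLimit.Theorems.BoundaryClosureR.Negative

open BoundaryClosure.Negative

/-! ### Mid-edges of a finite domain form a finite set -/

/-- The mid-edges of a finite hexagonal domain form a finite set (every face has three neighbours).
[folklore] -/
theorem finite_hexDomainMidEdges (Λ : Finset HexVertex) : (hexDomainMidEdges Λ).Finite := by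
  have h : hexDomainMidEdges Λ ⊆
      ⋃ v ∈ (Λ : Set HexVertex), (fun w => s(v, w)) '' (hexGraph.neighborSet v) := by
    rintro e ⟨he, v, hv, hvΛ⟩
    obtain ⟨w, rfl⟩ := Sym2.mem_iff_exists.1 hv
    exact Set.mem_biUnion (Finset.mem_coe.2 hvΛ) ⟨w, (SimpleGraph.mem_edgeSet hexGraph).1 he, rfl⟩
  refine Set.Finite.subset (Set.Finite.biUnion (Finset.finite_toSet Λ) fun v _ => Set.Finite.image _ ?_) h
  exact Set.finite_of_ncard_ne_zero (by rw [card_neighborSet_hexGraph_holds v]; norm_num)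

/-! ### The root edge hanging below cell `k` of row `0` -/

/-- The vertical mid-edge below the up-face of cell `k` in row `0` (lower endpoint in row `-1`). [folklore] -/
def hang (k : ℕ) : Sym2 HexVertex := s(fj (2 * k) 0, fj (2 * k + 1) (-1))

/-- The two endpoints of `hang k` are adjacent. [folklore] -/
theorem adj_hang (k : ℕ) : hexGraph.Adj (fj (2 * k) 0) (fj (2 * k + 1) (-1)) := by
  have := adj_fj_down (show (2 * (k : ℤ)) % 2 = 0 by omega) 0
  rwa [zero_sub] at this

/-- `fj 0 0 ∼ fj 1 (-1)` (the normalisation edge `bEdge`). [folklore] -/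
theorem adj_bEdge : hexGraph.Adj (fj 0 0) (fj 1 (-1)) := by
  have := adj_fj_down (show (0 : ℤ) % 2 = 0 by omega) 0
  rwa [zero_sub, zero_add] at this

/-- The midpoint of `hang k` is the real number `k + 1/2`. [folklore] -/
theorem hexMidpoint_hang (k : ℕ) : hexMidpoint (hang k) = (((k : ℝ) + 1 / 2 : ℝ) : ℂ) := by
  unfold hang
  rw [hexMidpoint_mk]
  apply Complex.ext
  · simp only [Complex.add_re, Complex.div_ofNat_re, re_hexCenter_fj, Complex.ofReal_re]
    push_cast; ring
  · simp only [Complex.add_im, Complex.div_ofNat_im, im_hexCenter_fj, Complex.ofReal_im]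
    rw [show (2 * (k : ℤ)) % 2 = 0 by omega, show (2 * (k : ℤ) + 1) % 2 = 1 by omega]
    push_cast; ring

/-- `hang k ≠ bEdge` for `k ≠ 0`. [folklore] -/
theorem hang_ne_bEdge {k : ℕ} (hk : k ≠ 0) : hang k ≠ bEdge := by
  intro h
  have hm : fj (2 * k) 0 ∈ bEdge := h ▸ Sym2.mem_mk_left _ _
  unfold bEdge at hm
  rcases Sym2.mem_iff.1 hm with h1 | h1
  · have := (fj_inj.1 h1).1; omega
  · have := (fj_inj.1 h1).2; omega

/-! ### The chart taking `hang k` to the standard entrance -/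

/-- The chart `hvIso ∘ shift (-k, 0)`: coordinates, translated so that the root cell is cell `0`.
[folklore] -/
def chartK (k : ℕ) : hexGraph ≃g hvGraph := hvIso.trans (HV.shift (-(k : ℤ)) 0)

/-- The chart in `fj`-coordinates. [folklore] -/
theorem chartK_fj (k : ℕ) (j r : ℤ) :
    chartK k (fj j r) = (j / 2 - k, r, decide ((fj j r).2 = 1)) := by
  show ((fj j r).1 0 + -(k : ℤ), (fj j r).1 1 + 0, decide ((fj j r).2 = 1)) = _
  rw [fj_fst_zero, fj_fst_one, add_zero, ← sub_eq_add_neg]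

/-- The chart sends the outer endpoint of the root edge to `wOut`. [folklore] -/
theorem chartK_u (k : ℕ) : chartK k (fj (2 * k + 1) (-1)) = wOut := by
  rw [chartK_fj, fj_snd_of_odd (by omega)]
  show ((2 * (k : ℤ) + 1) / 2 - k, (-1 : ℤ), decide ((1 : Fin 2) = 1)) = ((0 : ℤ), (-1 : ℤ), true)
  have e : (2 * (k : ℤ) + 1) / 2 - k = 0 := by omega
  rw [e]; rfl

/-- The chart sends the inner endpoint of the root edge to the origin. [folklore] -/
theorem chartK_w (k : ℕ) : chartK k (fj (2 * k) 0) = hvOrigin := by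
  rw [chartK_fj, fj_snd_of_even (by omega)]
  show ((2 * (k : ℤ)) / 2 - k, (0 : ℤ), decide ((0 : Fin 2) = 1)) = ((0 : ℤ), (0 : ℤ), false)
  have e : (2 * (k : ℤ)) / 2 - k = 0 := by omega
  rw [e]; rfl

/-- The chart on the inner endpoint of `bEdge`. [folklore] -/
theorem chartK_v0 (k : ℕ) : chartK k (fj 0 0) = (-(k : ℤ), 0, false) := by
  rw [chartK_fj, fj_snd_of_even (by omega)]
  show ((0 : ℤ) / 2 - k, (0 : ℤ), decide ((0 : Fin 2) = 1)) = _
  have e : (0 : ℤ) / 2 - k = -(k : ℤ) := by omega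
  rw [e]; rfl

/-- The chart on the outer endpoint of `bEdge`. [folklore] -/
theorem chartK_t0 (k : ℕ) : chartK k (fj 1 (-1)) = (-(k : ℤ), -1, true) := by
  rw [chartK_fj, fj_snd_of_odd (by omega)]
  show ((1 : ℤ) / 2 - k, (-1 : ℤ), decide ((1 : Fin 2) = 1)) = _
  have e : (1 : ℤ) / 2 - k = -(k : ℤ) := by omega
  rw [e]; rfl

/-- The final dart of the coded walks: `bEdge` seen from cell `k`, an `α`-dart at abscissa `-k`.
[folklore] -/
def dartK (k : ℕ) : HV × HV := ((-(k : ℤ), 0, false), (-(k : ℤ), -1, true))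

/-- `dartK k` lies on `α ∖ {a}`. [folklore] -/
theorem isAlphaDart_dartK (k : ℕ) : IsAlphaDart (dartK k) := ⟨rfl, rfl, rfl⟩

/-- `dartK` is injective. [folklore] -/
theorem dartK_injective : Function.Injective dartK := by
  intro k k' h
  have := congrArg (fun d : HV × HV => d.1.1) h
  simp only [dartK, neg_inj, Nat.cast_inj] at this
  exact this

/-! ### Coding the walks `hang k → bEdge` by α-arcs of the coordinate model -/

section Code

variable {Λ : Finset HexVertex} {k : ℕ}

/-- A walk `hang k → bEdge` (`k ≠ 0`) is nontrivial. [folklore] -/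
theorem verts_ne_nil (hk : k ≠ 0) (γ : HexMidEdgeSAW Λ (hang k) bEdge) : γ.verts ≠ [] :=
  fun h => hang_ne_bEdge hk (γ.eq_of_nil h)

/-- Its last vertex is the inner endpoint `fj 0 0` of `bEdge` (the outer one is not a vertex). [folklore] -/
theorem getLast_eq (ht : fj 1 (-1) ∉ Λ) (γ : HexMidEdgeSAW Λ (hang k) bEdge) (hne : γ.verts ≠ []) :
    γ.verts.getLast hne = fj 0 0 := by
  rcases γ.getLast_eq_or (v := fj 0 0) (t := fj 1 (-1)) hne with h | h
  · exact h
  · exact absurd (h ▸ γ.subset _ (List.getLast_mem hne)) ht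

/-- The code of a walk `hang k → bEdge`: `wOut :: chartK k (v₁, …, vₙ) ++ [chartK k (fj 1 (-1))]`. [folklore] -/
def codeK (k : ℕ) (γ : HexMidEdgeSAW Λ (hang k) bEdge) : List HV :=
  wOut :: (γ.verts.map (chartK k) ++ [chartK k (fj 1 (-1))])

/-- The code is a mid-edge walk of the coordinate model in `chartK k (Λ)`. [folklore] -/
theorem isMidWalk_codeK (hk : k ≠ 0) (ht : fj 1 (-1) ∉ Λ) (hu : fj (2 * k + 1) (-1) ∉ Λ)
    (γ : HexMidEdgeSAW Λ (hang k) bEdge) :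
    IsMidWalk (Λ.map (chartK k).toEquiv.toEmbedding) (codeK k γ) :=
  γ.isMidWalk_code (chartK k) (u := fj (2 * k + 1) (-1)) (w₁ := fj (2 * k) 0)
    (by unfold hang; exact Sym2.eq_swap) hu (chartK_u k) (chartK_w k) adj_bEdge (verts_ne_nil hk γ)
    (Or.inl ⟨getLast_eq ht γ _, rfl⟩)

/-- The coding is injective. [folklore] -/
theorem codeK_injective (k : ℕ) : Function.Injective (codeK (Λ := Λ) k) := by
  intro γ₁ γ₂ h
  apply HexMidEdgeSAW.ext
  have h1 : γ₁.verts.map (chartK k) ++ [chartK k (fj 1 (-1))] =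
      γ₂.verts.map (chartK k) ++ [chartK k (fj 1 (-1))] := (List.cons.inj h).2
  exact (List.map_injective_iff.2 (chartK k).injective) (List.append_cancel_right h1)

/-- The final dart of the code is `dartK k`. [folklore] -/
theorem finalDart_codeK (hk : k ≠ 0) (ht : fj 1 (-1) ∉ Λ) (γ : HexMidEdgeSAW Λ (hang k) bEdge) :
    finalDart (codeK k γ) = dartK k := by
  have hne := verts_ne_nil hk γ
  have hne' : γ.verts.map (chartK k) ≠ [] := by simpa using hne
  unfold codeK
  rw [finalDart_cons_append hne', List.getLast_map hne', getLast_eq ht γ hne, chartK_v0, chartK_t0]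
  rfl

/-- The code has length `ℓ(γ)`. [folklore] -/
theorem mwLen_codeK (γ : HexMidEdgeSAW Λ (hang k) bEdge) : mwLen (codeK k γ) = γ.length := by
  unfold codeK
  rw [mwLen_cons_append, List.length_map]
  rfl

/-- **Coding bound**: the `σ = 0` arrival mass at `bEdge` from the root `hang k` is at most the strip
sum over the mid-edge walks with final dart `dartK k` of any coordinate domain `V ⊇ chartK k (Λ)`.
[folklore] -/
theorem norm_obs_le_sum (hk : k ≠ 0) (ht : fj 1 (-1) ∉ Λ) (hu : fj (2 * k + 1) (-1) ∉ Λ)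
    {V : Finset HV} (hV : Λ.map (chartK k).toEquiv.toEmbedding ⊆ V) :
    ‖hexParafermionicObservable Λ (hang k) hexCriticalFugacity 0 bEdge‖ ≤
      ∑ P ∈ (midWalks V).filter (fun P => finalDart P = dartK k), hexCriticalFugacity ^ mwLen P := by
  have h0 := hexCriticalFugacity_pos_lt_one.1.le
  rw [hexParafermionicObservable_zero_spin, Complex.norm_real,
    Real.norm_of_nonneg (Finset.sum_nonneg fun γ _ => pow_nonneg h0 _)]
  calc ∑ γ : HexMidEdgeSAW Λ (hang k) bEdge, hexCriticalFugacity ^ γ.length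
      = ∑ γ : HexMidEdgeSAW Λ (hang k) bEdge, hexCriticalFugacity ^ mwLen (codeK k γ) := by
        simp only [mwLen_codeK]
    _ = ∑ P ∈ (Finset.univ : Finset (HexMidEdgeSAW Λ (hang k) bEdge)).image (codeK k),
          hexCriticalFugacity ^ mwLen P := by
        rw [Finset.sum_image fun γ _ γ' _ h => codeK_injective k h]
    _ ≤ ∑ P ∈ (midWalks V).filter (fun P => finalDart P = dartK k), hexCriticalFugacity ^ mwLen P := by
        refine Finset.sum_le_sum_of_subset_of_nonneg (fun P hP => ?_) fun _ _ _ => pow_nonneg h0 _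
        rw [Finset.mem_image] at hP
        obtain ⟨γ, -, rfl⟩ := hP
        rw [Finset.mem_filter, mem_midWalks_iff]
        exact ⟨(isMidWalk_codeK hk ht hu γ).mono hV, finalDart_codeK hk ht γ⟩

end Code

/-- **Arc bound for a family of roots** (DCS Lemma 2): if for every `k ∈ K` (`k ≠ 0`) the domain
`Λ k` misses the outer endpoints of `bEdge` and `hang k` and sits, in the chart `chartK k`, inside
the strip `S_{T,L}` (`T ≥ 1`), then `Σ_{k ∈ K} Z_{Λ k}(hang k → bEdge) ≤ A_{T,L}(x_c) ≤ 1/cos(3π/8)`: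
the codes are α-arcs of ONE strip with pairwise distinct final darts. [folklore] -/
theorem sum_norm_obs_le_stripA {K : Finset ℕ} (hK0 : ∀ k ∈ K, k ≠ 0) (Λ : ℕ → Finset HexVertex)
    (ht : ∀ k ∈ K, fj 1 (-1) ∉ Λ k) (hu : ∀ k ∈ K, fj (2 * k + 1) (-1) ∉ Λ k) {T L : ℕ} (hT : 1 ≤ T)
    (hV : ∀ k ∈ K, (Λ k).map (chartK k).toEquiv.toEmbedding ⊆ stripV T L) :
    ∑ k ∈ K, ‖hexParafermionicObservable (Λ k) (hang k) hexCriticalFugacity 0 bEdge‖ ≤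
      (Real.cos (3 * Real.pi / 8))⁻¹ := by
  have h0 := hexCriticalFugacity_pos_lt_one.1.le
  set A := (midWalks (stripV T L)).filter fun P => IsAlphaDart (finalDart P) with hA
  have step : ∀ k ∈ K, ‖hexParafermionicObservable (Λ k) (hang k) hexCriticalFugacity 0 bEdge‖ ≤
      ∑ P ∈ A, if finalDart P = dartK k then hexCriticalFugacity ^ mwLen P else 0 := by
    intro k hk
    refine (norm_obs_le_sum (hK0 k hk) (ht k hk) (hu k hk) (hV k hk)).trans (le_of_eq ?_)
    rw [← Finset.sum_filter]
    congr 1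
    ext P
    simp only [hA, Finset.mem_filter]
    constructor
    · rintro ⟨hP, hd⟩; exact ⟨⟨hP, hd ▸ isAlphaDart_dartK k⟩, hd⟩
    · rintro ⟨⟨hP, -⟩, hd⟩; exact ⟨hP, hd⟩
  have inner : ∀ P ∈ A, ∑ k ∈ K, (if finalDart P = dartK k then hexCriticalFugacity ^ mwLen P else 0) ≤
      hexCriticalFugacity ^ mwLen P := by
    intro P _
    rw [← Finset.sum_filter, Finset.sum_const, nsmul_eq_mul]
    have hc1 : (K.filter fun k => finalDart P = dartK k).card ≤ 1 :=
      Finset.card_le_one.2 fun a ha b hb => dartK_injective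
        (((Finset.mem_filter.1 ha).2).symm.trans (Finset.mem_filter.1 hb).2)
    have hcard : ((K.filter fun k => finalDart P = dartK k).card : ℝ) ≤ 1 := by
      exact_mod_cast hc1
    have hp : 0 ≤ hexCriticalFugacity ^ mwLen P := pow_nonneg h0 _
    nlinarith
  calc ∑ k ∈ K, ‖hexParafermionicObservable (Λ k) (hang k) hexCriticalFugacity 0 bEdge‖
      ≤ ∑ k ∈ K, ∑ P ∈ A, (if finalDart P = dartK k then hexCriticalFugacity ^ mwLen P else 0) :=
        Finset.sum_le_sum step
    _ = ∑ P ∈ A, ∑ k ∈ K, (if finalDart P = dartK k then hexCriticalFugacity ^ mwLen P else 0) :=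
        Finset.sum_comm
    _ ≤ ∑ P ∈ A, hexCriticalFugacity ^ mwLen P := Finset.sum_le_sum inner
    _ = stripA T L hexCriticalFugacity := rfl
    _ ≤ (Real.cos (3 * Real.pi / 8))⁻¹ := stripA_le_of_lemma2 DuminilCopinSmirnov2012_lemma2_holds hT L

/-! ### The half-disc family sits in one strip, in every chart -/

/-- In the chart `chartK k`, the half-disc family `Lam δ false` lies in the strip `S_{T,L}` as soon as
`T ≥ B + 1`, `L ≥ B + k` for an integer `B ≥ 4δ⁻¹`. [folklore] -/
theorem map_chartK_subset_stripV {δ : ℝ} (hδ : 0 < δ) (hδ' : δ ≤ 1 / 16) (k : ℕ) {B : ℤ}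
    (hB : 4 * δ⁻¹ ≤ B) {T L : ℕ} (hT : B + 1 ≤ T) (hL : B + k ≤ L) :
    (Lam δ false).map (chartK k).toEquiv.toEmbedding ⊆ stripV T L := by
  intro x hx
  rw [Finset.mem_map] at hx
  obtain ⟨v, hv, rfl⟩ := hx
  rw [← fj_jOf_rOf v] at hv ⊢
  set j := jOf v
  set r := rOf v
  rcases (fj_mem_Lam_iff hδ hδ').1 hv with hb | ⟨hwc, -⟩
  swap
  · exact absurd hwc (by decide)
  obtain ⟨hj, h0, hr⟩ := bounds_of_inStrip hδ hb.1
  have hjB : |j| ≤ B := by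
    have : |(j : ℝ)| ≤ B := hj.trans hB
    exact_mod_cast this
  have hrB : 2 * r ≤ B := by
    have : 2 * (r : ℝ) ≤ B := by linarith
    exact_mod_cast this
  rw [abs_le] at hjB
  show chartK k (fj j r) ∈ stripV T L
  rw [chartK_fj, mem_stripV_iff]
  have hbit : bit (j / 2 - (k : ℤ), r, decide ((fj j r).2 = 1)) ≤ 1 ∧
      0 ≤ bit (j / 2 - (k : ℤ), r, decide ((fj j r).2 = 1)) := by
    unfold bit; split_ifs <;> simp
  simp only [lev_mk]
  refine ⟨h0, ?_, ?_, ?_⟩ <;> omega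

end Summit.CriticalPhenomena.SAWScalingLimit.Theorems.BoundaryClosureR.Negative

end
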